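import Literature.NumberTheory.EllipticCurves.Kato2004.ZetaBodyTwistPairValuesTwoProofs
import Literature.NumberTheory.Automorphic.ShimuraCurveRibetTakahashiPeterssonTwoPowerLevelSevenProofs
import HarnessLib

/-!
# Kato 2004, Thm. 12.5 (1) for the PAIR `(f_W, f_{W″})`, `W″ = W^{(−2)}`, at `p = 2`: the `ψ`-weighted value of the
# transported datum `√−2·x″` (odd character `ψ·χ₈′` of `f″`) and of `x` (even character `ψ` of `f_W`) are PROPORTIONAL by ONE
# complex constant — `L(f″, ψχ₈′, s) = L(f_W, ψ, s)`, the twist element `√−2 = ζ₈ + ζ₈³` and Kato's guarded datum (THEOREMS ONLY)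

Topic `NumberTheory/EllipticCurves`, sub-directory `Kato2004` (namespace = path). THEOREMS ONLY (no `def`, no named fact, no
instance). Cell `bsd-2adic` (run/shared/lean/pub/bsd-2adic/), seat `bsd-2adic-addL2x` GEN 22 (crux stmt-BirchSwinnertonDyer-19098
`AdditiveRankZeroAtTwo`, child C4″ stmt-BirchSwinnertonDyer-22618; repair-census entry R-B85 (2): the ODD-BRANCH side of reading step
T22 (b) of the descent sockets on the (−2)-SPLIT-TWIST block — T22 (e) of `…AdditiveKatoDescentSocketDefs.lean`). The (−2)-twin of
`ZetaBodyTwistPairValuesTwoProofs.lean` (GEN 21, `W′ = W^{(−1)}`, twist element `i`, character `χ₄`), with the algebra of the two value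
laws now proved ONCE for an ABSTRACT odd twist character `ω` and twist element `s` with `ι(σ_b s) = ω(b)·t·I` (§4), so that `χ₄`/`i`
(`t = 1`) and `χ₈′`/`√−2` (`t = √2`) are instances. HONEST FRAMING: nothing about BSD or Kato's Main Conjecture is claimed; the
statements are CONDITIONAL on two `ZetaBody` witnesses `(W, f, κ, Λ, x)` and `(W″, f″, κ″, Λ″, x″)` over one guarded datum.

## The computation (Kato Thm. 12.5 (1) twice; socket docstring T22 (b)/(e))

Fix a level `M = 2^{n+2}` with `n ≥ 1` (so `8 ∣ M` and `√−2 = ζ₈ + ζ₈³ ∈ ℚ(ζ_M)`), the package embedding `ι = ι_M`, the twist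
element `s_M ∈ ℚ(ζ_M)` with `ι(s_M) = √2·I = √−2`, and an EVEN `ℚ(ζ_M)`-valued character `ψ` mod `M`, `ψ_ℂ = ψ ∘ ι`. Put
`ξ := Σ_b ψ(b) σ_b(x_{n+2,∅})`, `ξ″ := Σ_b ψ(b) σ_b(s_M · x″_{n+2,∅})`. Then:
* `ι(σ_b s_M) = χ₈′(b)·√2·I` (`s_M = ω + ω³` for the `ω` with `ι(ω) = e^{2πi/8}`; `e(k/8) + e(3k/8) = √2·I·χ₈′(k)` for odd `k` by the
  mod-`8` Gauss sums `e(m/8) = (√2/2)(χ₈(m) + iχ₈′(m))`, `χ₈(3) = −1`, `χ₈′(3) = 1`), so `ι(ξ″) = √2·I · Σ_b (ψ_ℂχ₈′)(b) ι(σ_b x″)` — the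
  character sum of `x″` at the ODD character `ψ_ℂ·χ₈′` (`χ₈′ = (−2/·)`, `χ₈′(−1) = −1`);
* the `(2A·M)`-depleted twisted series agree: `Σ (ψ_ℂχ₈′)(n) a_n(f″) n^{-s} = Σ ψ_ℂ(n) a_n(f_W) n^{-s}` since `a_n(f″) = χ₈′(n)a_n(f_W)`
  for odd `n` (`IsNewformOf.cuspCoeff_quadraticTwist_neg_two_of_odd`) and both characters kill even `n`; ONE entire continuation `L`;
* (C5) for `W` (even clause): `ι(ξ) = κ·L(1)/Ω⁺_f·R⁻`, `R⁻ = [a/A]⁻_f·cd(c − ψ̄(c))(d − ψ̄(d))` (Kato's datum, `c ≡ d ≡ 1 (A)`);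
  (C5) for `W″` (odd clause): `Σ_b (ψ_ℂχ₈′)(b) ι(σ_b x″) = −κ″·L(1)/(IΩ⁻_{f″})·R⁺`, `R⁺ = [a″/A]⁺_{f″}·cd(c − ψ̄(c))(d − ψ̄(d))` — the SAME
  character factor because `χ₈′(c) = χ₈′(d) = 1` (`c ≡ d ≡ 1 (8)` on the datum with `8 ∣ A`);
* hence **`C_W · ι(ξ″) = C_{W″} · ι(ξ)`** with `C_W = κ[a/A]⁻_f/Ω⁺_f ≠ 0`, `C_{W″} = −√2·κ″[a″/A]⁺_{f″}/Ω⁻_{f″} ≠ 0` INDEPENDENT of `n`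
  and `ψ`: one period ratio, as the socket docstring says.

Contents: §1 `exists_katoPairDatum_dvd` (ONE guarded datum with `q ∣ A` for any `q ≥ 1`, so `c ≡ d ≡ 1 (mod q)`); §2
`isDepletedTwistedL_twist_negTwo_of`; §3 `exists_embed_eq_sqrt_two_mul_I`, `embed_sigma_eq_chiEight'_mul`, `charSum_twistElement_eq`;
§4 `embed_twistSum_mul_eq_embed_sum_mul_of_valueLaws_of_twistChar` (abstract `ω`, `s`, `t`), `embed_twistSum_mul_eq_embed_sum_mul_negTwo`.

References: K. Kato, Astérisque 295 (2004), Thm. 12.5 (1) pp. 221–222, Thm. 9.7 p. 189, Thm. 6.6 (1) p. 163, Lemma 13.10 (1) p. 230,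
Ex. 13.3 p. 225 [Kato2004Asterisque]; J. H. Silverman, *AEC* (2009) X.5 Cor. 5.4, Ex. 10.16 [SilvermanAEC2009]; B. Mazur, J. Tate,
J. Teitelbaum, Invent. Math. 84 (1986) §I.8 [MazurTateTeitelbaum1986Invent]; J. E. Cremona, *Algorithms for modular elliptic curves*
(1997) §2.8 [CremonaAlgorithms1997]; L. C. Washington, *Introduction to Cyclotomic Fields* Ch. 2 [Washington1997].
-/

set_option autoImplicit false

noncomputable section

open scoped BigOperators NumberField TensorProduct MatrixGroups
open Field IsDedekindDomain CongruenceSubgroup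
open Literature.NumberTheory.GaloisRepresentations
open Literature.NumberTheory.EllipticCurves Literature.NumberTheory.EllipticCurves.ModularForms
open Literature.NumberTheory.EllipticCurves.Kato2004.EulerSystemValues Rat.HeightOneSpectrum

namespace Literature.NumberTheory.EllipticCurves.Kato2004

/-! ## §1 Kato's pair datum with a prescribed divisor of `A` -/

section PairDatum

variable {N : ℕ} [NeZero N] (f : CuspForm (Gamma0 N) 2)

/-- **Kato's guarded datum for a PAIR of rational newforms with `q ∣ A`** (`f ∈ S₂(Γ₀(N))`, `f′ ∈ S₂(Γ₀(N′))`, prime `p`, any `q ≥ 1`):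
ONE `A ≥ 1` with `q ∣ A`, cusps `a/A`, `a′/A` with `[a/A]⁻_f ≠ 0` and `[a′/A]⁺_{f′} ≠ 0` (common denominator of `exists_ratMinusSymbol_ne_zero`
for `f` and `exists_ratPlusSymbol_ne_zero` for `f′`), `c = 1 + 6pA`, `d = 1 + 6pANN′` — so `(c, 6pA) = (d, 6pN) = (d, 6pN′) = 1` (Ex. 13.3
for both newforms), `c ≡ d ≡ 1 (mod A)`, hence `c ≡ d ≡ 1 (mod q)`, and `c, d > 1`. With `q = 4` this is `exists_katoPairDatum`; the
(−2)-twist pair uses `q = 8` (`χ₈′(c) = χ₈′(d) = 1`). [cite: Kato2004Asterisque, Ex. 13.3 (p. 225) and 13.9 (p. 229)] -/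
theorem exists_katoPairDatum_dvd (hf : IsNewform0 f) (hQ : coeffField f = ⊥) {N' : ℕ} [NeZero N'] (f' : CuspForm (Gamma0 N') 2)
    (hf' : IsNewform0 f') (hQ' : coeffField f' = ⊥) (p : ℕ) [hp : Fact p.Prime] (q : ℕ) (hq : 0 < q) :
    ∃ (c d a a' : ℤ) (A : ℕ), 0 < A ∧ Int.gcd c (6 * p * A) = 1 ∧ Int.gcd d (6 * p * N) = 1 ∧ Int.gcd d (6 * p * N') = 1 ∧
      (A : ℤ) ∣ c - 1 ∧ (A : ℤ) ∣ d - 1 ∧ (q : ℤ) ∣ c - 1 ∧ (q : ℤ) ∣ d - 1 ∧ 1 < c ∧ 1 < d ∧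
      ratMinusSymbol f ((a : ℚ) / A) ≠ 0 ∧ ratPlusSymbol f' ((a' : ℚ) / A) ≠ 0 := by
  obtain ⟨r, hr⟩ := exists_ratMinusSymbol_ne_zero f hf hQ
  obtain ⟨r', hr'⟩ := exists_ratPlusSymbol_ne_zero f' hf' hQ'
  -- common denominator `A = q · den r · den r′`
  set A : ℕ := q * r.den * r'.den with hAdef
  have hA : 0 < A := by rw [hAdef]; exact Nat.mul_pos (Nat.mul_pos hq r.den_pos) r'.den_pos
  have hp1 : 1 ≤ (p : ℤ) := by exact_mod_cast hp.out.one_lt.le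
  have hA1 : 1 ≤ (A : ℤ) := by exact_mod_cast hA
  have hN1 : 1 ≤ (N : ℤ) := by exact_mod_cast Nat.pos_of_ne_zero (NeZero.ne N)
  have hN'1 : 1 ≤ (N' : ℤ) := by exact_mod_cast Nat.pos_of_ne_zero (NeZero.ne N')
  have hpos₁ : (0 : ℤ) < 6 * p * A := by positivity
  have hpos₂ : (0 : ℤ) < 6 * p * A * N * N' := by positivity
  have hqQ : (q : ℚ) ≠ 0 := by exact_mod_cast hq.ne'
  -- the cusps over `A`: `a = num r · q den r′`, `a′ = num r′ · q den r`
  have hra : ((r.num * (q * r'.den) : ℤ) : ℚ) / A = r := by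
    rw [hAdef]; push_cast
    have hd : (r.den : ℚ) ≠ 0 := by exact_mod_cast r.den_pos.ne'
    have hd' : (r'.den : ℚ) ≠ 0 := by exact_mod_cast r'.den_pos.ne'
    rw [show (r.num : ℚ) * ((q : ℚ) * (r'.den : ℚ)) / ((q : ℚ) * (r.den : ℚ) * (r'.den : ℚ)) = (r.num : ℚ) / r.den by
      field_simp]
    exact r.num_div_den
  have hra' : ((r'.num * (q * r.den) : ℤ) : ℚ) / A = r' := by
    rw [hAdef]; push_cast
    have hd : (r.den : ℚ) ≠ 0 := by exact_mod_cast r.den_pos.ne'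
    have hd' : (r'.den : ℚ) ≠ 0 := by exact_mod_cast r'.den_pos.ne'
    rw [show (r'.num : ℚ) * ((q : ℚ) * (r.den : ℚ)) / ((q : ℚ) * (r.den : ℚ) * (r'.den : ℚ)) = (r'.num : ℚ) / r'.den by
      field_simp]
    exact r'.num_div_den
  have hqA : (q : ℤ) ∣ (A : ℤ) := ⟨r.den * r'.den, by rw [hAdef]; push_cast; ring⟩
  refine ⟨1 + 6 * p * A, 1 + 6 * p * A * N * N', r.num * (q * r'.den), r'.num * (q * r.den), A, hA,
    ?_, ?_, ?_, ?_, ?_, ?_, ?_, ?_, ?_, ?_, ?_⟩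
  · rw [← Int.isCoprime_iff_gcd_eq_one]; exact ⟨1, -1, by ring⟩
  · rw [← Int.isCoprime_iff_gcd_eq_one]; exact ⟨1, -((A : ℤ) * N'), by ring⟩
  · rw [← Int.isCoprime_iff_gcd_eq_one]; exact ⟨1, -((A : ℤ) * N), by ring⟩
  · exact ⟨6 * p, by ring⟩
  · exact ⟨6 * p * N * N', by ring⟩
  · obtain ⟨k, hk⟩ := hqA
    exact ⟨6 * p * k, by linear_combination (6 * (p : ℤ)) * hk⟩
  · obtain ⟨k, hk⟩ := hqA
    exact ⟨6 * p * k * N * N', by linear_combination (6 * (p : ℤ) * N * N') * hk⟩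
  · linarith
  · linarith
  · rwa [hra]
  · rwa [hra']

end PairDatum

/-! ## §2 The twisted `L`-series: `L_{(2AM)}(f″, ψχ₈′, s) = L_{(2AM)}(f_W, ψ, s)` -/

section TwistedSeries

variable {N N' : ℕ} [NeZero N] [NeZero N'] {W : WeierstrassCurve ℚ} [W.IsElliptic]
  {f : CuspForm (Gamma0 N) 2} {f' : CuspForm (Gamma0 N') 2}

/-- The complex character `χ₈′ = (−2/·)` lifted to a modulus `M` with `8 ∣ M`: its value at the class of a natural number `n` coprime to
`M` is `χ₈′(n)`. [folklore] -/
private theorem changeLevel_chiEight'_apply_natCast {M : ℕ} [NeZero M] (h8 : 8 ∣ M) {n : ℕ} (hn : IsUnit (n : ZMod M)) :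
    DirichletCharacter.changeLevel h8 (ZMod.χ₈'.ringHomComp (Int.castRingHom ℂ)) (n : ZMod M) = (ZMod.χ₈' n : ℂ) := by
  obtain ⟨u, hu⟩ := hn
  rw [← hu, DirichletCharacter.changeLevel_eq_cast_of_dvd _ h8 u, hu, ZMod.cast_natCast h8, MulChar.ringHomComp_apply]
  rfl

/-- `χ₈′(n)² = 1` for odd `n`. [folklore] -/
private theorem χ₈'_sq_eq_one_of_odd {n : ℕ} (hn : ¬ 2 ∣ n) : (ZMod.χ₈' n : ℤ) ^ 2 = 1 := by
  rw [ZMod.χ₈'_nat_eq_if_mod_eight, if_neg (by omega)]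
  split_ifs <;> norm_num

/-- **The depleted twisted series of `f″` by `ψ·χ₈′` is the depleted twisted series of `f_W` by `ψ`** (`W″ = W^{(−2)}`, `f`, `f″` the
newforms; `8 ∣ M`): an entire continuation `L` of `Σ_{(n, 2AM)=1} ψ(n) a_n(f) n^{-s}` is one of `Σ_{(n,2AM)=1} (ψχ₈′)(n) a_n(f″) n^{-s}`,
because the two Dirichlet series coincide term by term — for `n` prime to `2AM` (odd) `a_n(f″) = χ₈′(n) a_n(f)`
(`IsNewformOf.cuspCoeff_quadraticTwist_neg_two_of_odd`) and `χ₈′(n)² = 1`; for the other `n` both characters vanish. The (−2)-twin of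
`isDepletedTwistedL_twist_of`. [cite: SilvermanAEC2009, X.5 Cor. 5.4 and Exercise 10.16] [cite: Kato2004Asterisque, §6.2 (p. 161)] -/
theorem isDepletedTwistedL_twist_negTwo_of (hf : IsNewformOf W f) (hf' : IsNewformOf (W.quadraticTwist (-2)) f') {M : ℕ}
    [NeZero M] (h8 : 8 ∣ M) (B : ℕ) [NeZero (M * B)] (ψ : DirichletCharacter ℂ M) {L : ℂ → ℂ} (hL : IsDepletedTwistedL f M B ψ L) :
    IsDepletedTwistedL f' M B (ψ * DirichletCharacter.changeLevel h8 (ZMod.χ₈'.ringHomComp (Int.castRingHom ℂ))) L := by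
  refine ⟨hL.1, fun s hs ↦ ?_⟩
  rw [hL.2 s hs]
  unfold twistedLSeries
  congr 1
  funext n
  set ω : DirichletCharacter ℂ M := DirichletCharacter.changeLevel h8 (ZMod.χ₈'.ringHomComp (Int.castRingHom ℂ)) with hω
  by_cases hu : IsUnit ((n : ℕ) : ZMod (M * B))
  · -- `n` prime to `M·B`: odd, and the characters are evaluated at the class of `n` mod `M`
    have hcop : n.Coprime (M * B) := (ZMod.isUnit_iff_coprime n (M * B)).mp hu
    have h2M : 2 ∣ M * B := (show (2 : ℕ) ∣ 8 by norm_num).trans (h8.trans (dvd_mul_right M B))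
    have hodd : ¬ 2 ∣ n := fun h2 ↦ by
      have := Nat.Coprime.coprime_dvd_left h2 hcop
      exact absurd (Nat.Coprime.eq_one_of_dvd this h2M) (by norm_num)
    have huM : IsUnit ((n : ℕ) : ZMod M) := (ZMod.isUnit_iff_coprime n M).mpr (hcop.coprime_dvd_right (dvd_mul_right M B))
    obtain ⟨v, hv⟩ := hu
    have hcl : ∀ χ : DirichletCharacter ℂ M, DirichletCharacter.changeLevel (dvd_mul_right M B) χ (n : ZMod (M * B)) =
        χ (n : ZMod M) := fun χ ↦ by
      rw [← hv, DirichletCharacter.changeLevel_eq_cast_of_dvd χ (dvd_mul_right M B) v, hv,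
        ZMod.cast_natCast (dvd_mul_right M B)]
    rw [hcl, hcl, MulChar.mul_apply, hω, changeLevel_chiEight'_apply_natCast h8 huM,
      Literature.NumberTheory.EllipticCurves.ModularForms.IsNewformOf.cuspCoeff_quadraticTwist_neg_two_of_odd hf hf' hodd]
    have hsq : ((ZMod.χ₈' n : ℤ) : ℂ) * ((ZMod.χ₈' n : ℤ) : ℂ) = 1 := by
      have := χ₈'_sq_eq_one_of_odd hodd
      rw [sq] at this
      exact_mod_cast this
    linear_combination (-(ψ (n : ZMod M) * cuspCoeff f n)) * hsq
  · -- `n` not prime to `M·B`: both characters vanish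
    rw [MulChar.map_nonunit _ hu, MulChar.map_nonunit _ hu, zero_mul, zero_mul]

end TwistedSeries

/-! ## §3 The twist element `s_M` (`ι(s_M) = √2·I = √−2`) and the character sums of `s_M · x″` -/

section TwistElement

variable {M : ℕ} [NeZero M] (ιM : CyclotomicField M ℚ →+* ℂ)

set_option backward.isDefEq.respectTransparency false in
/-- For `8 ∣ M` there is `ω ∈ ℚ(ζ_M)` with `ι(ω) = e^{2πi/8}`: `e^{2πi/8}` is an `M`-th root of unity of `ℂ`, and the embedding of a
primitive `M`-th root of unity of `ℚ(ζ_M)` hits every `M`-th root of unity of `ℂ`. [cite: Washington1997, Ch. 2] -/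
theorem exists_embed_eq_exp_eighth (h8 : 8 ∣ M) :
    ∃ ω : CyclotomicField M ℚ, ιM ω = Complex.exp (2 * Real.pi * Complex.I / 8) ∧ ω ^ M = 1 := by
  have hζ := IsCyclotomicExtension.zeta_spec M ℚ (CyclotomicField M ℚ)
  have hζC : IsPrimitiveRoot (ιM (IsCyclotomicExtension.zeta M ℚ (CyclotomicField M ℚ))) M := hζ.map_of_injective ιM.injective
  have h8r : IsPrimitiveRoot (Complex.exp (2 * Real.pi * Complex.I / 8)) 8 := by
    have := Complex.isPrimitiveRoot_exp 8 (by norm_num)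
    simpa using this
  have hE : Complex.exp (2 * Real.pi * Complex.I / 8) ^ M = 1 := by
    obtain ⟨q, hq⟩ := h8
    rw [hq, pow_mul, h8r.pow_eq_one, one_pow]
  obtain ⟨j, -, hj⟩ := hζC.eq_pow_of_pow_eq_one hE
  refine ⟨IsCyclotomicExtension.zeta M ℚ (CyclotomicField M ℚ) ^ j, by rw [map_pow, hj], ?_⟩
  rw [← pow_mul, mul_comm, pow_mul, hζ.pow_eq_one, one_pow]

/-- **`e(k/8) + e(3k/8) = χ₈′(k)·√2·I` for odd `k`** — from the mod-`8` Gauss sums `e(m/8) = (√2/2)(χ₈(m) + iχ₈′(m))`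
(`Automorphic.exp_two_pi_I_mul_div_eight_of_odd`) at `m = k` and `m = 3k`, with `χ₈(3) = −1`, `χ₈′(3) = 1`. [folklore] -/
private theorem exp_eighth_pow_add_pow_three_mul_of_odd {k : ℕ} (hk : ¬ 2 ∣ k) :
    Complex.exp (2 * Real.pi * Complex.I / 8) ^ k + Complex.exp (2 * Real.pi * Complex.I / 8) ^ (3 * k) =
      (ZMod.χ₈' k : ℂ) * (((Real.sqrt 2 : ℝ) : ℂ) * Complex.I) := by
  have hkodd : Odd (k : ℤ) := by exact_mod_cast Nat.odd_iff.mpr (by omega)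
  have h3kodd : Odd ((3 * k : ℕ) : ℤ) := by
    have : Odd (3 * k) := Nat.odd_mul.mpr ⟨by decide, Nat.odd_iff.mpr (by omega)⟩
    exact_mod_cast this
  have e1 : Complex.exp (2 * Real.pi * Complex.I / 8) ^ k = Complex.exp (2 * Real.pi * Complex.I * (k : ℤ) / 8) := by
    rw [← Complex.exp_nat_mul]; push_cast; ring_nf
  have e3 : Complex.exp (2 * Real.pi * Complex.I / 8) ^ (3 * k) =
      Complex.exp (2 * Real.pi * Complex.I * ((3 * k : ℕ) : ℤ) / 8) := by
    rw [← Complex.exp_nat_mul]; push_cast; ring_nf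
  rw [e1, e3, Literature.NumberTheory.Automorphic.exp_two_pi_I_mul_div_eight_of_odd hkodd,
    Literature.NumberTheory.Automorphic.exp_two_pi_I_mul_div_eight_of_odd h3kodd]
  -- `χ₈(3k) = −χ₈(k)`, `χ₈′(3k) = χ₈′(k)`
  have hm8 : ZMod.χ₈ ((3 * k : ℕ) : ℤ) = -ZMod.χ₈ ((k : ℕ) : ℤ) := by
    push_cast
    rw [map_mul, show ZMod.χ₈ (3 : ZMod 8) = -1 from by decide]
    ring
  have hm8' : ZMod.χ₈' ((3 * k : ℕ) : ℤ) = ZMod.χ₈' ((k : ℕ) : ℤ) := by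
    push_cast
    rw [map_mul, show ZMod.χ₈' (3 : ZMod 8) = 1 from by decide]
    ring
  rw [hm8, hm8']
  push_cast
  ring

set_option backward.isDefEq.respectTransparency false in
/-- For `8 ∣ M` there is `s_M ∈ ℚ(ζ_M)` with `ι(s_M) = √2·I` (`= √−2`): `s_M = ω + ω³` for `ι(ω) = e^{2πi/8}`
(`e(1/8) + e(3/8) = √2·I`). [cite: Washington1997, Ch. 2] -/
theorem exists_embed_eq_sqrt_two_mul_I (h8 : 8 ∣ M) :
    ∃ s : CyclotomicField M ℚ, ιM s = ((Real.sqrt 2 : ℝ) : ℂ) * Complex.I := by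
  obtain ⟨ω, hω, -⟩ := exists_embed_eq_exp_eighth ιM h8
  refine ⟨ω + ω ^ 3, ?_⟩
  rw [map_add, map_pow, hω]
  have h := exp_eighth_pow_add_pow_three_mul_of_odd (k := 1) (by norm_num)
  rw [pow_one, mul_one, show ZMod.χ₈' ((1 : ℕ) : ZMod 8) = 1 from by decide] at h
  rw [h]
  push_cast
  ring

set_option backward.isDefEq.respectTransparency false in
/-- **`ι(σ_b s_M) = χ₈′(b)·√2·I`** for `8 ∣ M` and `ι(s_M) = √2·I`: `s_M = ω + ω³` with `ι(ω) = e^{2πi/8}` (injectivity of `ι`), `σ_b`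
raises the `M`-th roots of unity to the `b`-th power (`sigma_apply_of_pow_eq_one`), and `e(b/8) + e(3b/8) = χ₈′(b)√2·I` for the odd
`b`. The (−2)-twin of `embed_sigma_eq_chiFour_mul_I`. [cite: Kato2004Asterisque, (5.7.1) (p. 157)] -/
theorem embed_sigma_eq_chiEight'_mul (h8 : 8 ∣ M) {s : CyclotomicField M ℚ} (hs : ιM s = ((Real.sqrt 2 : ℝ) : ℂ) * Complex.I)
    (b : (ZMod M)ˣ) :
    ιM (sigma M b s) = (ZMod.χ₈' (b : ZMod M).val : ℂ) * (((Real.sqrt 2 : ℝ) : ℂ) * Complex.I) := by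
  obtain ⟨ω, hω, hωM⟩ := exists_embed_eq_exp_eighth ιM h8
  -- `s = ω + ω³`
  have hsω : s = ω + ω ^ 3 := by
    apply ιM.injective
    rw [hs, map_add, map_pow, hω]
    have h := exp_eighth_pow_add_pow_three_mul_of_odd (k := 1) (by norm_num)
    rw [pow_one, mul_one, show ZMod.χ₈' ((1 : ℕ) : ZMod 8) = 1 from by decide] at h
    rw [h]
    push_cast
    ring
  have hω3M : (ω ^ 3) ^ M = 1 := by rw [← pow_mul, mul_comm, pow_mul, hωM, one_pow]
  rw [hsω, map_add, sigma_apply_of_pow_eq_one M b ω hωM, sigma_apply_of_pow_eq_one M b (ω ^ 3) hω3M, map_add, map_pow, map_pow,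
    map_pow, hω, ← pow_mul]
  -- `val b` is odd (`b` a unit, `M` even)
  set k : ℕ := (b : ZMod M).val with hk
  have hcop : k.Coprime M := by rw [hk]; exact ZMod.val_coe_unit_coprime b
  have hodd : ¬ 2 ∣ k := by
    have h2M : 2 ∣ M := (show (2 : ℕ) ∣ 8 by norm_num).trans h8
    intro h2k
    exact absurd (Nat.Coprime.eq_one_of_dvd (Nat.Coprime.coprime_dvd_left h2k hcop) h2M) (by norm_num)
  exact exp_eighth_pow_add_pow_three_mul_of_odd hodd

set_option backward.isDefEq.respectTransparency false in
/-- **The character sum of `s · x″` at `ψ` is `t·I` times the character sum of `x″` at the twisted character `ψ·ω`**, for ANY twist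
element `s` and Dirichlet character `ω` mod `M` with `ι(σ_b s) = ω(b)·t·I` for all units `b`:
`Σ_b ψ_ℂ(b) ι(σ_b(s x″)) = t·I · Σ_b (ψ_ℂ·ω)(b) ι(σ_b x″)` (`σ_b` multiplicative). [cite: Kato2004Asterisque, Thm. 6.6 (1) (p. 163) and (5.7.1) (p. 157)] -/
theorem charSum_twistElement_eq {s : CyclotomicField M ℚ} (ω : DirichletCharacter ℂ M) (t : ℂ)
    (hσs : ∀ b : (ZMod M)ˣ, ιM (sigma M b s) = ω (b : ZMod M) * (t * Complex.I)) (ψ : DirichletCharacter ℂ M)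
    (x' : CyclotomicField M ℚ) :
    ∑ b : (ZMod M)ˣ, ψ (b : ZMod M) * ιM (sigma M b (s * x')) = t * Complex.I * charSum M ιM (ψ * ω) x' := by
  unfold charSum
  rw [Finset.mul_sum]
  refine Finset.sum_congr rfl fun b _ ↦ ?_
  rw [map_mul, map_mul, hσs b, MulChar.mul_apply]
  ring

/-- The instance `ω = χ₈′`, `t = √2`: `Σ_b ψ_ℂ(b) ι(σ_b(s_M x″)) = √2·I · Σ_b (ψ_ℂ·χ₈′)(b) ι(σ_b x″)` for `8 ∣ M`, `ι(s_M) = √2·I`.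
[cite: Kato2004Asterisque, Thm. 6.6 (1) (p. 163) and (5.7.1) (p. 157)] -/
theorem charSum_twist_negTwo_eq (h8 : 8 ∣ M) {s : CyclotomicField M ℚ} (hs : ιM s = ((Real.sqrt 2 : ℝ) : ℂ) * Complex.I)
    (ψ : DirichletCharacter ℂ M) (x' : CyclotomicField M ℚ) :
    ∑ b : (ZMod M)ˣ, ψ (b : ZMod M) * ιM (sigma M b (s * x')) =
      ((Real.sqrt 2 : ℝ) : ℂ) * Complex.I *
        charSum M ιM (ψ * DirichletCharacter.changeLevel h8 (ZMod.χ₈'.ringHomComp (Int.castRingHom ℂ))) x' := by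
  refine charSum_twistElement_eq ιM _ _ (fun b ↦ ?_) ψ x'
  have hbu : IsUnit ((b : ZMod M).val : ZMod M) := by
    rw [ZMod.natCast_zmod_val]; exact Units.isUnit b
  rw [embed_sigma_eq_chiEight'_mul ιM h8 hs b, ← ZMod.natCast_zmod_val (b : ZMod M), changeLevel_chiEight'_apply_natCast h8 hbu,
    ZMod.natCast_zmod_val]

end TwistElement

/-! ## §4 The value comparison: `C_W · ι(ξ″) = C_{W″} · ι(ξ)` — abstract algebra of the two value laws, then at `p = 2` -/

section Algebra

variable {M : ℕ} [NeZero M] {N N' : ℕ} [NeZero N] [NeZero N'] (f : CuspForm (Gamma0 N) 2) (f' : CuspForm (Gamma0 N') 2)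

set_option backward.isDefEq.respectTransparency false in
/-- **The algebra of the two value laws (Kato Thm. 6.6 (1) / 9.7 read on Kato's datum), for an ABSTRACT odd twist.** At a level `M`,
an embedding `ι_M`, a twist element `s` and a Dirichlet character `ω` mod `M` with `ι_M(σ_b s) = ω(b)·t·I` for all units `b` and
`ω(c) = ω(d) = 1`, an EVEN `ℚ(ζ_M)`-valued character `ψ` with complex shadow `ψ_ℂ = ψ ∘ ι_M`, elements `x, x′ ∈ ℚ(ζ_M)` and ONE number
`L₁ ∈ ℂ`: IF `Σ_b ψ_ℂ(b)ι(σ_b x) = κ·(L₁/Ω⁺_f)·R⁻_{ψ̄_ℂ}(c,d,a,A,1)` (even clause of (C5) for `f`) and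
`Σ_b (ψ_ℂω)(b)ι(σ_b x′) = −κ′·(L₁/(IΩ⁻_{f′}))·R⁺_{(ψ_ℂω)‾}(c,d,a′,A,1)` (odd clause for `f′`), with `c ≡ 1 (mod A)`, `Ω⁺_f, Ω⁻_{f′} ≠ 0`,
THEN `(κ[a/A]⁻_f/Ω⁺_f) · ι(Σ_b ψ(b)σ_b(s x′)) = (−t·κ′[a′/A]⁺_{f′}/Ω⁻_{f′}) · ι(Σ_b ψ(b)σ_b x)`: both four-cusp factors collapse to the SAME
character factor `cd(c − ψ̄(c))(d − ψ̄(d))` times `[a/A]⁻_f` resp. `[a′/A]⁺_{f′}`. Instances: `W^{(−1)}` (`s = i`, `ω = χ₄`, `t = 1`: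
`embed_twistSum_mul_eq_embed_sum_mul_of_valueLaws`) and `W^{(−2)}` (`s = √−2`, `ω = χ₈′`, `t = √2`).
[cite: Kato2004Asterisque, Thm. 6.6 (1) (p. 163), Lemma 13.10 (1) (p. 230), Thm. 12.5 (1) (pp. 221–222)] -/
theorem embed_twistSum_mul_eq_embed_sum_mul_of_valueLaws_of_twistChar (ιM : CyclotomicField M ℚ →+* ℂ)
    {s : CyclotomicField M ℚ} (ω : DirichletCharacter ℂ M) (t : ℂ)
    (hσs : ∀ b : (ZMod M)ˣ, ιM (sigma M b s) = ω (b : ZMod M) * (t * Complex.I))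
    (ψ : DirichletCharacter (CyclotomicField M ℚ) M) (ψC : DirichletCharacter ℂ M) (hψC : ψC = ψ.ringHomComp ιM)
    (xW xT : CyclotomicField M ℚ) {κ κ' : ℝ} {L₁ : ℂ} {c d a a' : ℤ} {A : ℕ} (hA : 0 < A) (hcA : (A : ℤ) ∣ c - 1)
    (hωc : ω (c : ZMod M) = 1) (hωd : ω (d : ZMod M) = 1)
    (hΩ : (plusPeriod f : ℂ) ≠ 0) (hΩ' : (minusPeriod f' : ℂ) ≠ 0)
    (h5W : charSum M ιM ψC xW =
      (κ : ℂ) * (L₁ / (plusPeriod f : ℂ)) * cuspFactor f true (fun k ↦ ψC⁻¹ (k : ZMod M)) c d a A 1)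
    (h5T : charSum M ιM (ψC * ω) xT =
      -(κ' : ℂ) * (L₁ / (Complex.I * (minusPeriod f' : ℂ))) * cuspFactor f' false (fun k ↦ (ψC * ω)⁻¹ (k : ZMod M)) c d a' A 1) :
    ((κ : ℂ) * ((ratMinusSymbol f ((a : ℚ) / A) : ℚ) : ℂ) / (plusPeriod f : ℂ)) *
        ιM (∑ b : (ZMod M)ˣ, ψ (b : ZMod M) * sigma M b (s * xT)) =
      (-(t * (κ' : ℂ)) * ((ratPlusSymbol f' ((a' : ℚ) / A) : ℚ) : ℂ) / (minusPeriod f' : ℂ)) *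
        ιM (∑ b : (ZMod M)ˣ, ψ (b : ZMod M) * sigma M b xW) := by
  -- the two embedded sums are character sums
  have hsumW : ιM (∑ b : (ZMod M)ˣ, ψ (b : ZMod M) * sigma M b xW) = charSum M ιM ψC xW := by
    unfold charSum
    rw [map_sum]
    refine Finset.sum_congr rfl fun b _ ↦ ?_
    rw [map_mul, hψC, MulChar.ringHomComp_apply]
  have hsumT : ιM (∑ b : (ZMod M)ˣ, ψ (b : ZMod M) * sigma M b (s * xT)) = t * Complex.I * charSum M ιM (ψC * ω) xT := by
    rw [map_sum, ← charSum_twistElement_eq ιM ω t hσs ψC xT]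
    refine Finset.sum_congr rfl fun b _ ↦ ?_
    rw [map_mul, hψC, MulChar.ringHomComp_apply]
  -- the cusp factors on Kato's datum: the SAME character factor `cd (c − ψ̄(c)) (d − ψ̄(d))`
  have hinvT : ∀ {e : ℤ}, ω (e : ZMod M) = 1 → (ψC * ω)⁻¹ (e : ZMod M) = ψC⁻¹ (e : ZMod M) := by
    intro e he
    rw [mul_inv, MulChar.mul_apply, MulChar.inv_apply_eq_inv' ω, he, inv_one, mul_one]
  have hRW : cuspFactor f true (fun k ↦ ψC⁻¹ (k : ZMod M)) c d a A 1 =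
      ((ratMinusSymbol f ((a : ℚ) / A) : ℚ) : ℂ) *
        ((c : ℂ) * (d : ℂ) * (((c : ℂ) - ψC⁻¹ (c : ZMod M)) * ((d : ℂ) - ψC⁻¹ (d : ZMod M)))) := by
    rw [cuspFactor_true_eq_of_dvd_sub_one f _ hA hcA, Int.cast_mul, map_mul]
    ring
  have hRT : cuspFactor f' false (fun k ↦ (ψC * ω)⁻¹ (k : ZMod M)) c d a' A 1 =
      ((ratPlusSymbol f' ((a' : ℚ) / A) : ℚ) : ℂ) *
        ((c : ℂ) * (d : ℂ) * (((c : ℂ) - ψC⁻¹ (c : ZMod M)) * ((d : ℂ) - ψC⁻¹ (d : ZMod M)))) := by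
    rw [cuspFactor_false_eq_of_dvd_sub_one f' _ hA hcA, Int.cast_mul, map_mul, hinvT hωc, hinvT hωd]
    ring
  -- assemble: atomise the common factors, then a field identity (`I · I⁻¹ = 1`)
  have hI : Complex.I ≠ 0 := Complex.I_ne_zero
  rw [hsumT, hsumW, h5W, h5T, hRW, hRT]
  generalize ((ratMinusSymbol f ((a : ℚ) / A) : ℚ) : ℂ) = RM
  generalize ((ratPlusSymbol f' ((a' : ℚ) / A) : ℚ) : ℂ) = RP
  generalize ((c : ℂ) * (d : ℂ) * (((c : ℂ) - ψC⁻¹ (c : ZMod M)) * ((d : ℂ) - ψC⁻¹ (d : ZMod M)))) = Φ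
  generalize (plusPeriod f : ℂ) = ΩW at hΩ ⊢
  generalize (minusPeriod f' : ℂ) = ΩT at hΩ' ⊢
  field_simp

end Algebra

section PairValues

variable {W : WeierstrassCurve ℚ} [W.IsElliptic] [ContinuousSMul ℤ_[2] (W.tateModule 2)]
  [Module.Free ℤ_[2] (W.tateModule 2)] [Module.Finite ℤ_[2] (W.tateModule 2)]
  [(W.quadraticTwist (-2)).IsElliptic] [ContinuousSMul ℤ_[2] ((W.quadraticTwist (-2)).tateModule 2)]
  [Module.Free ℤ_[2] ((W.quadraticTwist (-2)).tateModule 2)] [Module.Finite ℤ_[2] ((W.quadraticTwist (-2)).tateModule 2)]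
  {N N' : ℕ} [NeZero N] [NeZero N']
  {f : CuspForm (Gamma0 N) 2} {f' : CuspForm (Gamma0 N') 2} {ι : (m : ℕ) → (CyclotomicField m ℚ →+* ℂ)} {κ κ' : ℝ}
  {Λ : ∀ (k : ℕ) (r : Finset (HeightOneSpectrum (𝓞 ℚ))),
    H1 (tateRep W 2) (cycSubgroup 2 k r) →ₗ[ℤ_[2]] ℚ_[2] ⊗[ℚ] CyclotomicField (cycLevel 2 k r) ℚ}
  {Λ' : ∀ (k : ℕ) (r : Finset (HeightOneSpectrum (𝓞 ℚ))),
    H1 (tateRep (W.quadraticTwist (-2)) 2) (cycSubgroup 2 k r) →ₗ[ℤ_[2]] ℚ_[2] ⊗[ℚ] CyclotomicField (cycLevel 2 k r) ℚ}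
  {c d a a' : ℤ} {A : ℕ}
  {z : ∀ (k : ℕ) (r : (cyclotomicLevelsRat 2 (badPlaces c d A N)).Ideals),
    H1 (tateRep W 2) ((cyclotomicLevelsRat 2 (badPlaces c d A N)).level k r.1)}
  {x : ∀ (k : ℕ) (r : (cyclotomicLevelsRat 2 (badPlaces c d A N)).Ideals), CyclotomicField (cycLevel 2 k r.1) ℚ}
  {z' : ∀ (k : ℕ) (r : (cyclotomicLevelsRat 2 (badPlaces c d A N')).Ideals),
    H1 (tateRep (W.quadraticTwist (-2)) 2) ((cyclotomicLevelsRat 2 (badPlaces c d A N')).level k r.1)}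
  {x' : ∀ (k : ℕ) (r : (cyclotomicLevelsRat 2 (badPlaces c d A N')).Ideals), CyclotomicField (cycLevel 2 k r.1) ℚ}

/-- `8 ∣ 2^{n+2} = cycLevel 2 (n+2) ∅` for `n ≥ 1`. [folklore] -/
private theorem eight_dvd_cycLevel_two {n : ℕ} (hn : 1 ≤ n) : 8 ∣ cycLevel 2 (n + 2) ∅ := by
  have hM : cycLevel 2 (n + 2) ∅ = 2 ^ (n + 2) := by simp [cycLevel]
  rw [hM]
  obtain ⟨m, rfl⟩ : ∃ m, n = m + 1 := ⟨n - 1, by omega⟩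
  rw [show m + 1 + 2 = 3 + m by ring, pow_add]
  exact Dvd.intro _ rfl

set_option backward.isDefEq.respectTransparency false in
/-- **Kato Thm. 12.5 (1) for the pair `(f_W, f_{W″})`, `W″ = W^{(−2)}`, at one level, one even character: `C_W · ι(ξ″) = C_{W″} · ι(ξ)`.**
Data: the two `ZetaBody` witnesses at `p = 2` over ONE guarded datum (`(c,12A) = (d,12N) = (d,12N′) = 1`, `c ≡ d ≡ 1 (mod A)` and
`(mod 8)`), `f`, `f″` the newforms of `W`, `W″ = W^{(−2)}`; a level `M = 2^{n+2}` with `n ≥ 1`; `s_M` with `ι_M(s_M) = √2·I`; an EVEN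
`ℚ(ζ_M)`-valued character `ψ`. With `ξ = Σ_b ψ(b)σ_b(x_{n+2,∅})`, `ξ″ = Σ_b ψ(b)σ_b(s_M·x″_{n+2,∅})`:
`(κ·[a/A]⁻_f/Ω⁺_f) · ι(ξ″) = (−√2·κ″·[a″/A]⁺_{f″}/Ω⁻_{f″}) · ι(ξ)` — the two value laws (C5) (even clause for `W` at `ψ_ℂ`, odd clause
for `W″` at `ψ_ℂχ₈′`) with ONE entire continuation of the common depleted series (`exists_differentiable_eq_twistedLSeries_holds`,
`isDepletedTwistedL_twist_negTwo_of`), then `embed_twistSum_mul_eq_embed_sum_mul_of_valueLaws_of_twistChar`. The constants do not depend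
on `n` or `ψ`: ONE period ratio. The (−2)-twin of `embed_twistSum_mul_eq_embed_sum_mul`.
[cite: Kato2004Asterisque, Thm. 12.5 (1) (pp. 221–222), Thm. 9.7 (p. 189), Thm. 6.6 (1) (p. 163), Lemma 13.10 (1) (p. 230)]
[cite: SilvermanAEC2009, X.5 Cor. 5.4 and Exercise 10.16] -/
theorem embed_twistSum_mul_eq_embed_sum_mul_negTwo (hbody : ZetaBody W 2 f ι κ Λ c d a A z x)
    (hbody' : ZetaBody (W.quadraticTwist (-2)) 2 f' ι κ' Λ' c d a' A z' x')
    (hf : IsNewformOf W f) (hf' : IsNewformOf (W.quadraticTwist (-2)) f') (hA : 0 < A)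
    (hc : Int.gcd c (6 * 2 * A) = 1) (hd : Int.gcd d (6 * 2 * N) = 1) (hd' : Int.gcd d (6 * 2 * N') = 1)
    (hcA : (A : ℤ) ∣ c - 1) (hdA : (A : ℤ) ∣ d - 1) (hc8 : (8 : ℤ) ∣ c - 1) (hd8 : (8 : ℤ) ∣ d - 1)
    (n : ℕ) (hn : 1 ≤ n) {s : CyclotomicField (cycLevel 2 (n + 2) ∅) ℚ}
    (hs : ι (cycLevel 2 (n + 2) ∅) s = ((Real.sqrt 2 : ℝ) : ℂ) * Complex.I)
    (ψ : DirichletCharacter (CyclotomicField (cycLevel 2 (n + 2) ∅) ℚ) (cycLevel 2 (n + 2) ∅)) (hψ : ψ.Even)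
    (xT : CyclotomicField (cycLevel 2 (n + 2) ∅) ℚ) (hxT : xT = x' (n + 2) (cyclotomicLevelsRat 2 (badPlaces c d A N')).idealOne) :
    ((κ : ℂ) * ((ratMinusSymbol f ((a : ℚ) / A) : ℚ) : ℂ) / (plusPeriod f : ℂ)) *
        ι (cycLevel 2 (n + 2) ∅) (∑ b : (ZMod (cycLevel 2 (n + 2) ∅))ˣ, ψ (b : ZMod (cycLevel 2 (n + 2) ∅)) *
          sigma (cycLevel 2 (n + 2) ∅) b (s * xT)) =
      (-((((Real.sqrt 2 : ℝ) : ℂ)) * (κ' : ℂ)) * ((ratPlusSymbol f' ((a' : ℚ) / A) : ℚ) : ℂ) / (minusPeriod f' : ℂ)) *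
        ι (cycLevel 2 (n + 2) ∅) (∑ b : (ZMod (cycLevel 2 (n + 2) ∅))ˣ, ψ (b : ZMod (cycLevel 2 (n + 2) ∅)) *
          sigma (cycLevel 2 (n + 2) ∅) b (x (n + 2) (cyclotomicLevelsRat 2 (badPlaces c d A N)).idealOne)) := by
  subst hxT
  have hM : cycLevel 2 (n + 2) ∅ = 2 ^ (n + 2) := by simp [cycLevel]
  have h8 : 8 ∣ cycLevel 2 (n + 2) ∅ := eight_dvd_cycLevel_two hn
  set ω : DirichletCharacter ℂ (cycLevel 2 (n + 2) ∅) :=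
    DirichletCharacter.changeLevel h8 (ZMod.χ₈'.ringHomComp (Int.castRingHom ℂ)) with hω
  have hψCe : (ψ.ringHomComp (ι (cycLevel 2 (n + 2) ∅))) (-1) = 1 :=
    (LayerCharacterTwo.even_ringHomComp_iff ψ (ι (cycLevel 2 (n + 2) ∅)).injective).mpr hψ
  have hωodd : ω (-1) = -1 := by
    rw [hω, ← Units.coe_neg_one, DirichletCharacter.changeLevel_eq_cast_of_dvd _ h8, Units.coe_neg_one, ZMod.cast_neg h8,
      ZMod.cast_one h8, MulChar.ringHomComp_apply]
    rw [show ZMod.χ₈' (-1 : ZMod 8) = -1 from by decide]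
    simp
  have hψωodd : (ψ.ringHomComp (ι (cycLevel 2 (n + 2) ∅)) * ω) (-1) = -1 := by
    rw [MulChar.mul_apply, hψCe, hωodd, one_mul]
  -- one entire continuation for both depleted series
  haveI : NeZero (cycLevel 2 (n + 2) ∅ * (2 * A)) := ⟨mul_ne_zero (NeZero.ne _) (mul_ne_zero two_ne_zero hA.ne')⟩
  obtain ⟨L, hLd, hLs⟩ := exists_differentiable_eq_twistedLSeries_holds f (m := cycLevel 2 (n + 2) ∅ * (2 * A))
    (DirichletCharacter.changeLevel (dvd_mul_right (cycLevel 2 (n + 2) ∅) (2 * A)) (ψ.ringHomComp (ι (cycLevel 2 (n + 2) ∅))))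
  have hdepW : IsDepletedTwistedL f (cycLevel 2 (n + 2) ∅) (2 * A) (ψ.ringHomComp (ι (cycLevel 2 (n + 2) ∅))) L := ⟨hLd, hLs⟩
  have hdepT := isDepletedTwistedL_twist_negTwo_of hf hf' h8 (2 * A) (ψ.ringHomComp (ι (cycLevel 2 (n + 2) ∅))) hdepW
  -- the guards of (C5)
  have hdd' : d * 1 ≡ 1 [ZMOD (A : ℤ)] := by
    rw [mul_one, Int.modEq_iff_dvd]
    obtain ⟨k, hk⟩ := hdA
    exact ⟨-k, by linear_combination -hk⟩
  have hcdW := gcd_mul_cycLevel_mul_eq_one_of_guards (p := 2) (N := N) hc hd hdd' (n + 1)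
  have hcdT := gcd_mul_cycLevel_mul_eq_one_of_guards (p := 2) (N := N') hc hd' hdd' (n + 1)
  -- (C5) for `W` at the even `ψ_ℂ` and for `W″` at the odd `ψ_ℂ·χ₈′`
  have h5W := ((hbody.2.2.2.2.2) (n + 2) (cyclotomicLevelsRat 2 (badPlaces c d A N)).idealOne 1
    (ψ.ringHomComp (ι (cycLevel 2 (n + 2) ∅))) L hcdW hdd' hdepW).1 hψCe
  have h5T := ((hbody'.2.2.2.2.2) (n + 2) (cyclotomicLevelsRat 2 (badPlaces c d A N')).idealOne 1 _ L hcdT hdd' hdepT).2 hψωodd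
  have hΩ : (plusPeriod f : ℂ) ≠ 0 := by exact_mod_cast (IsNewform0.plusPeriod_pos_holds hf.1 hf.coeffField_eq_bot).ne'
  have hΩ' : (minusPeriod f' : ℂ) ≠ 0 := by
    exact_mod_cast (IsNewform0.minusPeriod_pos_holds hf'.1 hf'.coeffField_eq_bot).ne'
  -- `χ₈′(c) = χ₈′(d) = 1` on the datum
  have hcM : IsUnit (c : ZMod (cycLevel 2 (n + 2) ∅)) := isUnit_intCast_zmod_of_gcd_eq_one hc n hM
  have hdM : IsUnit (d : ZMod (cycLevel 2 (n + 2) ∅)) := isUnit_intCast_zmod_of_gcd_eq_one hd n hM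
  have hω1 : ∀ {e : ℤ}, (8 : ℤ) ∣ e - 1 → IsUnit (e : ZMod (cycLevel 2 (n + 2) ∅)) → ω (e : ZMod (cycLevel 2 (n + 2) ∅)) = 1 := by
    intro e he heu
    obtain ⟨v, hv⟩ := heu
    rw [hω, ← hv, DirichletCharacter.changeLevel_eq_cast_of_dvd _ h8 v, hv, ZMod.cast_intCast h8, MulChar.ringHomComp_apply]
    have h1 : (e : ZMod 8) = 1 := by
      obtain ⟨q, hq⟩ := he
      have : e = 8 * q + 1 := by linear_combination hq
      rw [this]; push_cast; rw [show (8 : ZMod 8) = 0 from by decide]; ring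
    rw [h1, map_one, map_one]
  have hσs : ∀ b : (ZMod (cycLevel 2 (n + 2) ∅))ˣ, ι (cycLevel 2 (n + 2) ∅) (sigma (cycLevel 2 (n + 2) ∅) b s) =
      ω (b : ZMod (cycLevel 2 (n + 2) ∅)) * (((Real.sqrt 2 : ℝ) : ℂ) * Complex.I) := fun b ↦ by
    have hbu : IsUnit ((b : ZMod (cycLevel 2 (n + 2) ∅)).val : ZMod (cycLevel 2 (n + 2) ∅)) := by
      rw [ZMod.natCast_zmod_val]; exact Units.isUnit b
    rw [embed_sigma_eq_chiEight'_mul (ι (cycLevel 2 (n + 2) ∅)) h8 hs b, hω, ← ZMod.natCast_zmod_val (b : ZMod (cycLevel 2 (n + 2) ∅)),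
      changeLevel_chiEight'_apply_natCast h8 hbu, ZMod.natCast_zmod_val]
  exact embed_twistSum_mul_eq_embed_sum_mul_of_valueLaws_of_twistChar f f' (ι (cycLevel 2 (n + 2) ∅)) ω _ hσs ψ _ rfl _ _ hA hcA
    (hω1 hc8 hcM) (hω1 hd8 hdM) hΩ hΩ' h5W h5T

end PairValues

end Literature.NumberTheory.EllipticCurves.Kato2004

end
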